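import Summits.NavierStokesRegularity.NavierStokesRegularity.Theorems.TerminalTraceTypeITraceScarL3SqrtTwoApexShellBounds
import Summits.NavierStokesRegularity.NavierStokesRegularity.Theorems.TerminalTraceTypeITraceScarL3SqrtTwoCalculus
import HarnessLib

/-!
# The time layer of ROUND-27 «THE √2 APEX» (T27-A′ ⇒ T27-A modulo shell data): the identity package of the
# cut-off velocity of a classical flow on `]s₁, 0[` with quiet-annulus bounds, and `2 ≤ C²`
# (item `TerminalTrace.TypeITraceScarL3`, stmt-NavierStokesRegularity-18385, Stub LOUD line; helpers)

Seat nsreg-C26-p1 g2 (cell ns-regularity-ideate), `--supports stmt-NavierStokesRegularity-18385` (helper);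
planner-of-record nsreg-p2 g29 (ROUND-27 §1, T27-A′ `IdentityPackage` + the CHECKED calculus
`two_le_rateSq_of_identities`, tree `…SqrtTwoCalculus`).

SETTING (`…SqrtTwoApexCutoffCalculus`, `…SliceIdentities`, `…ShellBounds`): `V` jointly smooth on the open
time interval `]s₁, 0[`, divergence free, solving the unit-viscosity Navier–Stokes equations classically near
every time (for SOME smooth pressure `q` on a window — only its gauge-free shell budget `∫_K |q(t) − c| ≤ m_P` on
the annulus `K = {ρ₁ ≤ |y| ≤ ρ₂}` enters); a smooth cut-off `φ` (`= 1` on `|y| ≤ ρ₁`, `= 0` on `|y| ≥ ρ₂`,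
`0 ≤ φ ≤ 1`, `‖Dφ‖ ≤ C_φ`); sup bounds `B` on `K` for `V, ΔV, Δ(φV), DΔ(φV)` at all times; the RATE
`‖V(t, y)‖ ≤ C/√(−t)` on the support of `φ`.  With `w = φV`, `E = ∫‖w‖²`, `D = ∫|∇w|²_F`, `Q₀ = ∫‖Δw‖²`,
`Λ = D/E`, `X = ∫⟪Δw + Λw, (V·∇)w⟫`:

* `hasDerivAt_cutoffEnergy_shell` / `abs_energySource_le` — `E' = −2D + 2S₁`, `|S₁| ≤ m₁`;
* `hasDerivAt_cutoffEnstrophy_shell` / `abs_enstrophySource_le` — `D' = −2Q₀ + 2X − 2S₂`, `|S₂| ≤ m₂`;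
* `abs_drift_le` — Ghidaglia: `|X| ≤ (C/√(−t)) (Q₀ − D²/E)^{1/2} D^{1/2}` (when `E > 0`);
* **`two_le_rateSq_of_shellData`** — if moreover `E ≥ c√(−t)` (the transported cubic floor) and `E → 0`
  (strong extinction), then `2 ≤ C²` (tree `two_le_rateSq_of_identities`).

WHAT THIS IS NOT: not T27-A (the floor, the extinction, the annulus bounds and the shell pressure budget are
hypotheses here), not Stub LOUD, not NS regularity.  [folklore; Ghidaglia 1986; Temam IDDS 1997 §III.6]
-/

noncomputable section

set_option linter.dupNamespace false

namespace Summit.NavierStokesRegularity.NavierStokesRegularity.Theorems.TypeITraceScarL3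

open MeasureTheory Set Function Filter Topology Metric InnerProductSpace
open Literature.Analysis.FluidPDE
open scoped RealInnerProductSpace Laplacian ContDiff

variable {V : ℝ → EuclideanSpace ℝ (Fin 3) → EuclideanSpace ℝ (Fin 3)} {φ : EuclideanSpace ℝ (Fin 3) → ℝ}
  {s₁ ρ₁ ρ₂ B Cφ mP C : ℝ}

/-- A cut-off vanishing on `|y| ≥ ρ₂` has compact support. -/
theorem hasCompactSupport_of_cutoff (hφ0 : ∀ y : EuclideanSpace ℝ (Fin 3), ρ₂ ≤ ‖y‖ → φ y = 0) :
    HasCompactSupport φ := by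
  refine HasCompactSupport.intro (isCompact_closedBall (0 : EuclideanSpace ℝ (Fin 3)) ρ₂) fun y hy => ?_
  rw [mem_closedBall_zero_iff, not_le] at hy
  exact hφ0 y hy.le

/-- The momentum equation at a time `t` of a window, with the two-sided time derivative. -/
theorem momentum_slice_of_window {a c t : ℝ} {q : ℝ → EuclideanSpace ℝ (Fin 3) → ℝ}
    (hcl : IsClassicalNSSolutionOn (Ioo a c) 1 0 V q) (ht : t ∈ Ioo a c) :
    ∀ y, (fun y => deriv (fun s => V s y) t) y + convect (V t) (V t) y = (Δ (V t)) y - gradient (q t) y := by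
  intro y
  have h := hcl.momentum t ht y
  rw [timeDerivWithin_eq_deriv isOpen_Ioo ht, one_smul, Pi.zero_apply, Pi.zero_apply, add_zero] at h
  exact h

/-- **`E' = −2D + 2S₁`** with `S₁ = D + ∫⟪w, φ∂ₜV⟫`. [folklore] -/
theorem hasDerivAt_cutoffEnergy_shell
    (hV : IsSmoothSpaceTimeOn (Ioo s₁ 0) V) (hφ : ContDiff ℝ ∞ φ) (hφc : HasCompactSupport φ)
    {t : ℝ} (ht : t ∈ Ioo s₁ 0) :
    HasDerivAt (fun s => ∫ y, ‖φ y • V s y‖ ^ 2)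
      (-2 * (∫ y, frobeniusNormSq (fderiv ℝ (fun y => φ y • V t y) y)) +
        2 * ((∫ y, frobeniusNormSq (fderiv ℝ (fun y => φ y • V t y) y)) +
          ∫ y, ⟪φ y • V t y, φ y • deriv (fun s => V s y) t⟫)) t := by
  have h := hasDerivAt_integral_norm_sq_cutoff isOpen_Ioo hV hφ hφc ht
  refine h.congr_deriv ?_
  ring

/-- **`D' = −2Q₀ + 2X − 2S₂`** with `S₂ = ∫⟪Δw, φ∂ₜV⟫ − Q₀ + X` (Green: `Σᵢ∫⟪∂ᵢw, ∂ᵢ(φ∂ₜV)⟫ = −∫⟪Δw, φ∂ₜV⟫`).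
[folklore] -/
theorem hasDerivAt_cutoffEnstrophy_shell
    (hV : IsSmoothSpaceTimeOn (Ioo s₁ 0) V) (hφ : ContDiff ℝ ∞ φ) (hφc : HasCompactSupport φ)
    {t : ℝ} (ht : t ∈ Ioo s₁ 0) (Q₀ X : ℝ) :
    HasDerivAt (fun s => ∫ y, frobeniusNormSq (fderiv ℝ (fun y => φ y • V s y) y))
      (-2 * Q₀ + 2 * X -
        2 * ((∫ y, ⟪(Δ (fun y => φ y • V t y)) y, φ y • deriv (fun s => V s y) t⟫) - Q₀ + X)) t := by
  have h := hasDerivAt_integral_frobeniusNormSq_cutoff isOpen_Ioo hV hφ hφc ht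
  have hwt : ContDiff ℝ ∞ (fun y => φ y • V t y) := hφ.smul (hV.contDiff_slice ht)
  have hwtc : HasCompactSupport (fun y => φ y • V t y) := hφc.smul_right
  have hzt : ContDiff ℝ ∞ (fun y => φ y • deriv (fun s => V s y) t) :=
    hφ.smul ((hV.isSmoothSpaceTimeOn_deriv isOpen_Ioo).contDiff_slice ht)
  rw [sum_integral_inner_fderiv_eq_neg_integral_inner_laplacian hwt hwtc hzt] at h
  refine h.congr_deriv ?_
  ring

/-- **`|S₁| ≤ m₁`** on the annulus data (module docstring). [folklore] -/
theorem abs_energySource_le {t : ℝ} (hs₁t : t ∈ Ioo s₁ 0)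
    (hV : IsSmoothSpaceTimeOn (Ioo s₁ 0) V) (hdiv : VectorCalculus.IsDivFree (V t))
    (hwin : ∃ (a c : ℝ) (q : ℝ → EuclideanSpace ℝ (Fin 3) → ℝ), t ∈ Ioo a c ∧
      IsClassicalNSSolutionOn (Ioo a c) 1 0 V q ∧
      ∃ cst : ℝ, ∫ y in {y : EuclideanSpace ℝ (Fin 3) | ρ₁ ≤ ‖y‖ ∧ ‖y‖ ≤ ρ₂}, |q t y - cst| ≤ mP)
    (hφ : ContDiff ℝ ∞ φ) (hφ1 : ∀ y : EuclideanSpace ℝ (Fin 3), ‖y‖ ≤ ρ₁ → φ y = 1)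
    (hφ0 : ∀ y : EuclideanSpace ℝ (Fin 3), ρ₂ ≤ ‖y‖ → φ y = 0)
    (hφ01 : ∀ y, 0 ≤ φ y ∧ φ y ≤ 1) (hCφ : 0 ≤ Cφ) (hdφ : ∀ y, ‖fderiv ℝ φ y‖ ≤ Cφ) (hB : 0 ≤ B)
    (hbd : ∀ y ∈ {y : EuclideanSpace ℝ (Fin 3) | ρ₁ ≤ ‖y‖ ∧ ‖y‖ ≤ ρ₂},
      ‖V t y‖ ≤ B ∧ ‖(Δ (V t)) y‖ ≤ B ∧ ‖(Δ (fun y => φ y • V t y)) y‖ ≤ B) :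
    |(∫ y, frobeniusNormSq (fderiv ℝ (fun y => φ y • V t y) y)) +
        ∫ y, ⟪φ y • V t y, φ y • deriv (fun s => V s y) t⟫| ≤
      (2 * B ^ 2 + Cφ * B ^ 3) * (volume {y : EuclideanSpace ℝ (Fin 3) | ρ₁ ≤ ‖y‖ ∧ ‖y‖ ≤ ρ₂}).toReal +
        2 * Cφ * B * mP := by
  obtain ⟨a, c, q, htac, hcl, cst, hP⟩ := hwin
  have hVt : ContDiff ℝ ∞ (V t) := hV.contDiff_slice hs₁t
  have hVtt : ContDiff ℝ ∞ (fun y => deriv (fun s => V s y) t) :=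
    (hV.isSmoothSpaceTimeOn_deriv isOpen_Ioo).contDiff_slice hs₁t
  have hq : ContDiff ℝ ∞ (q t) := hcl.contDiff_pressure htac
  have hmom := momentum_slice_of_window hcl htac
  have hid := integral_inner_cutoff_timeDeriv_add_enstrophy_eq hVt hVtt hq hmom hdiv hφ
    (hasCompactSupport_of_cutoff hφ0)
  rw [add_comm] at hid
  rw [hid]
  exact abs_shellSource₁_le hVt hdiv hq.continuous hφ hφ1 hφ0 hφ01 hCφ hdφ hB (fun y hy => (hbd y hy).1)
    (fun y hy => (hbd y hy).2.1) (fun y hy => (hbd y hy).2.2) hP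

/-- **`|S₂| ≤ m₂`** on the annulus data, where `S₂ = ∫⟪Δw, φ∂ₜV⟫ − Q₀ + X` and
`X = ∫⟪Δw + Λw, (V·∇)w⟫` for ANY `Λ` (the `Λw` part of the drift pairing vanishes exactly). [folklore] -/
theorem abs_enstrophySource_le {t : ℝ} (hs₁t : t ∈ Ioo s₁ 0)
    (hV : IsSmoothSpaceTimeOn (Ioo s₁ 0) V) (hdiv : VectorCalculus.IsDivFree (V t))
    (hwin : ∃ (a c : ℝ) (q : ℝ → EuclideanSpace ℝ (Fin 3) → ℝ), t ∈ Ioo a c ∧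
      IsClassicalNSSolutionOn (Ioo a c) 1 0 V q ∧
      ∃ cst : ℝ, ∫ y in {y : EuclideanSpace ℝ (Fin 3) | ρ₁ ≤ ‖y‖ ∧ ‖y‖ ≤ ρ₂}, |q t y - cst| ≤ mP)
    (hφ : ContDiff ℝ ∞ φ) (hφ1 : ∀ y : EuclideanSpace ℝ (Fin 3), ‖y‖ ≤ ρ₁ → φ y = 1)
    (hφ0 : ∀ y : EuclideanSpace ℝ (Fin 3), ρ₂ ≤ ‖y‖ → φ y = 0)
    (hφ01 : ∀ y, 0 ≤ φ y ∧ φ y ≤ 1) (hCφ : 0 ≤ Cφ) (hdφ : ∀ y, ‖fderiv ℝ φ y‖ ≤ Cφ) (hB : 0 ≤ B)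
    (hbd : ∀ y ∈ {y : EuclideanSpace ℝ (Fin 3) | ρ₁ ≤ ‖y‖ ∧ ‖y‖ ≤ ρ₂},
      ‖V t y‖ ≤ B ∧ ‖(Δ (V t)) y‖ ≤ B ∧ ‖(Δ (fun y => φ y • V t y)) y‖ ≤ B ∧
        ‖fderiv ℝ (Δ (fun y => φ y • V t y)) y‖ ≤ B) (Λ : ℝ) :
    |(∫ y, ⟪(Δ (fun y => φ y • V t y)) y, φ y • deriv (fun s => V s y) t⟫) -
        (∫ y, ‖(Δ (fun y => φ y • V t y)) y‖ ^ 2) +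
        ∫ y, ⟪(Δ (fun y => φ y • V t y)) y + Λ • (φ y • V t y), convect (V t) (fun y => φ y • V t y) y⟫| ≤
      (2 * B ^ 2 + Cφ * B ^ 3) * (volume {y : EuclideanSpace ℝ (Fin 3) | ρ₁ ≤ ‖y‖ ∧ ‖y‖ ≤ ρ₂}).toReal +
        (3 + Cφ) * B * mP := by
  obtain ⟨a, c, q, htac, hcl, cst, hP⟩ := hwin
  have hφc := hasCompactSupport_of_cutoff hφ0
  have hVt : ContDiff ℝ ∞ (V t) := hV.contDiff_slice hs₁t
  have hVtt : ContDiff ℝ ∞ (fun y => deriv (fun s => V s y) t) :=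
    (hV.isSmoothSpaceTimeOn_deriv isOpen_Ioo).contDiff_slice hs₁t
  have hq : ContDiff ℝ ∞ (q t) := hcl.contDiff_pressure htac
  have hmom := momentum_slice_of_window hcl htac
  have hwt : ContDiff ℝ ∞ (fun y => φ y • V t y) := hφ.smul hVt
  have hwtc : HasCompactSupport (fun y => φ y • V t y) := hφc.smul_right
  have hw2 : ContDiff ℝ 2 (fun y => φ y • V t y) := hwt.of_le (by norm_cast)
  have hcΔw : Continuous (Δ (fun y => φ y • V t y)) := continuous_laplacian hw2
  have hΔws : HasCompactSupport (Δ (fun y => φ y • V t y)) :=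
    HasCompactSupport.intro hwtc fun y hy => laplacian_eq_zero_of_notMem_tsupport hy
  -- the `Λw` part of the drift pairing vanishes
  have hconvc : Continuous (convect (V t) (fun y => φ y • V t y)) := by
    have : convect (V t) (fun y => φ y • V t y) = fun y => fderiv ℝ (fun y => φ y • V t y) y (V t y) := rfl
    rw [this]
    exact ((hwt.of_le (by norm_cast : (1 : WithTop ℕ∞) ≤ ∞)).continuous_fderiv one_ne_zero).clm_apply
      hVt.continuous
  have i1 : Integrable (fun y => ⟪(Δ (fun y => φ y • V t y)) y, convect (V t) (fun y => φ y • V t y) y⟫)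
      (volume : Measure (EuclideanSpace ℝ (Fin 3))) :=
    (hcΔw.inner hconvc).integrable_of_hasCompactSupport
      (HasCompactSupport.intro hΔws fun y hy => by rw [image_eq_zero_of_notMem_tsupport hy, inner_zero_left])
  have i2 : Integrable (fun y => ⟪Λ • (φ y • V t y), convect (V t) (fun y => φ y • V t y) y⟫)
      (volume : Measure (EuclideanSpace ℝ (Fin 3))) :=
    (((hφ.continuous.smul hVt.continuous).const_smul Λ).inner hconvc).integrable_of_hasCompactSupport
      (HasCompactSupport.intro hwtc fun y hy => by
        rw [image_eq_zero_of_notMem_tsupport hy, smul_zero, inner_zero_left])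
  have hX : ∫ y, ⟪(Δ (fun y => φ y • V t y)) y + Λ • (φ y • V t y), convect (V t) (fun y => φ y • V t y) y⟫ =
      ∫ y, ⟪(Δ (fun y => φ y • V t y)) y, convect (V t) (fun y => φ y • V t y) y⟫ := by
    have h0 := integral_inner_convect_self_eq_zero_of_isDivFree hwt hwtc hVt hdiv
    have e : ∫ y, ⟪Λ • (φ y • V t y), convect (V t) (fun y => φ y • V t y) y⟫ = 0 := by
      have : ∫ y, ⟪Λ • (φ y • V t y), convect (V t) (fun y => φ y • V t y) y⟫ =
          Λ * ∫ y, ⟪φ y • V t y, convect (V t) (fun y => φ y • V t y) y⟫ := by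
        rw [← integral_const_mul]
        exact integral_congr_ae (Eventually.of_forall fun y => by dsimp only; rw [real_inner_smul_left])
      rw [this, h0, mul_zero]
    have hsplit : ∫ y, ⟪(Δ (fun y => φ y • V t y)) y + Λ • (φ y • V t y),
        convect (V t) (fun y => φ y • V t y) y⟫ =
        (∫ y, ⟪(Δ (fun y => φ y • V t y)) y, convect (V t) (fun y => φ y • V t y) y⟫) +
          ∫ y, ⟪Λ • (φ y • V t y), convect (V t) (fun y => φ y • V t y) y⟫ := by
      rw [← integral_add i1 i2]
      exact integral_congr_ae (Eventually.of_forall fun y => inner_add_left _ _ _)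
    rw [hsplit, e, add_zero]
  have hid := integral_inner_laplacian_cutoff_timeDeriv_eq hVt hVtt hq hmom hφ hφc
  rw [hX, hid]
  have key := abs_shellSource₂_le (c := cst) hVt hdiv hq.continuous hφ hφ1 hφ0 hφ01 hCφ hdφ hB
    (fun y hy => (hbd y hy).1) (fun y hy => (hbd y hy).2.1) (fun y hy => (hbd y hy).2.2.1)
    (fun y hy => (hbd y hy).2.2.2) hP
  refine le_of_eq_of_le ?_ key
  congr 1
  ring

/-- **Ghidaglia's bound on the drift pairing** `X = ∫⟪Δw + Λw, (V·∇)w⟫`, `Λ = D/E`, under the rate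
`‖V(t)‖ ≤ C/√(−t)` on the support of `φ`: `|X| ≤ (C/√(−t)) (Q₀ − D²/E)^{1/2} D^{1/2}`. [folklore; Ghidaglia 1986] -/
theorem abs_drift_le {t : ℝ} (hs₁t : t ∈ Ioo s₁ 0) (hV : IsSmoothSpaceTimeOn (Ioo s₁ 0) V)
    (hφ : ContDiff ℝ ∞ φ) (hφc : HasCompactSupport φ) (hC : 0 ≤ C)
    (hrate : ∀ y ∈ tsupport φ, ‖V t y‖ ≤ C / Real.sqrt (-t))
    (hE : 0 < ∫ y, ‖φ y • V t y‖ ^ 2) :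
    |∫ y, ⟪(Δ (fun y => φ y • V t y)) y +
        ((∫ y, frobeniusNormSq (fderiv ℝ (fun y => φ y • V t y) y)) / ∫ y, ‖φ y • V t y‖ ^ 2) •
          (φ y • V t y), convect (V t) (fun y => φ y • V t y) y⟫| ≤
      C / Real.sqrt (-t) *
        Real.sqrt ((∫ y, ‖(Δ (fun y => φ y • V t y)) y‖ ^ 2) -
          (∫ y, frobeniusNormSq (fderiv ℝ (fun y => φ y • V t y) y)) ^ 2 / ∫ y, ‖φ y • V t y‖ ^ 2) *
        Real.sqrt (∫ y, frobeniusNormSq (fderiv ℝ (fun y => φ y • V t y) y)) := by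
  have hVt : ContDiff ℝ ∞ (V t) := hV.contDiff_slice hs₁t
  have hwt : ContDiff ℝ ∞ (fun y => φ y • V t y) := hφ.smul hVt
  have hwtc : HasCompactSupport (fun y => φ y • V t y) := hφc.smul_right
  have hw2 : ContDiff ℝ 2 (fun y => φ y • V t y) := hwt.of_le (by norm_cast)
  have hcΔw : Continuous (Δ (fun y => φ y • V t y)) := continuous_laplacian hw2
  have hΔws : HasCompactSupport (Δ (fun y => φ y • V t y)) :=
    HasCompactSupport.intro hwtc fun y hy => laplacian_eq_zero_of_notMem_tsupport hy
  set Λ : ℝ := (∫ y, frobeniusNormSq (fderiv ℝ (fun y => φ y • V t y) y)) / ∫ y, ‖φ y • V t y‖ ^ 2 with hΛ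
  have hA : Continuous fun y => (Δ (fun y => φ y • V t y)) y + Λ • (φ y • V t y) :=
    hcΔw.add ((hφ.continuous.smul hVt.continuous).const_smul Λ)
  have hAc : HasCompactSupport fun y => (Δ (fun y => φ y • V t y)) y + Λ • (φ y • V t y) := by
    refine HasCompactSupport.intro hwtc fun y hy => ?_
    rw [laplacian_eq_zero_of_notMem_tsupport hy, image_eq_zero_of_notMem_tsupport hy, smul_zero, add_zero]
  have hβ : 0 ≤ C / Real.sqrt (-t) := div_nonneg hC (Real.sqrt_nonneg _)
  have hrate' : ∀ y ∈ tsupport (fun y => φ y • V t y), ‖V t y‖ ≤ C / Real.sqrt (-t) :=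
    fun y hy => hrate y (tsupport_smul_subset_left _ _ hy)
  have h := abs_integral_inner_convect_le hwt hwtc hVt.continuous hA hAc hβ hrate'
  rw [integral_norm_sq_laplacian_add_smul hwt hwtc Λ] at h
  have e : (∫ y, ‖(Δ (fun y => φ y • V t y)) y‖ ^ 2) -
      2 * Λ * (∫ y, frobeniusNormSq (fderiv ℝ (fun y => φ y • V t y) y)) +
        Λ ^ 2 * ∫ y, ‖φ y • V t y‖ ^ 2 =
      (∫ y, ‖(Δ (fun y => φ y • V t y)) y‖ ^ 2) -
        (∫ y, frobeniusNormSq (fderiv ℝ (fun y => φ y • V t y) y)) ^ 2 / ∫ y, ‖φ y • V t y‖ ^ 2 := by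
    rw [hΛ]
    field_simp
    ring
  rw [e] at h
  exact h


/-- **T27-A modulo shell data: `2 ≤ C²`.**  In the setting of the module docstring — classical flow on
`]s₁,0[`, quiet annulus with sup bounds, gauge-free shell pressure budget, RATE `C/√(−t)` on the support of
the cut-off, the transported cubic FLOOR `E ≥ c√(−t)` and strong EXTINCTION `E → 0` — the rate constant obeys
`2 ≤ C²`: the identity package of this file fed into the CHECKED calculus `two_le_rateSq_of_identities`.
[folklore; Ghidaglia 1986; Temam IDDS 1997 §III.6 L6.1; this is ROUND-27's «√2 apex» mechanism] -/
theorem two_le_rateSq_of_shellData (hs₁ : s₁ < 0)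
    (hV : IsSmoothSpaceTimeOn (Ioo s₁ 0) V) (hdiv : ∀ t ∈ Ioo s₁ 0, VectorCalculus.IsDivFree (V t))
    (hwin : ∀ t ∈ Ioo s₁ 0, ∃ (a c : ℝ) (q : ℝ → EuclideanSpace ℝ (Fin 3) → ℝ), t ∈ Ioo a c ∧
      IsClassicalNSSolutionOn (Ioo a c) 1 0 V q ∧
      ∃ cst : ℝ, ∫ y in {y : EuclideanSpace ℝ (Fin 3) | ρ₁ ≤ ‖y‖ ∧ ‖y‖ ≤ ρ₂}, |q t y - cst| ≤ mP)
    (hφ : ContDiff ℝ ∞ φ) (hφ1 : ∀ y : EuclideanSpace ℝ (Fin 3), ‖y‖ ≤ ρ₁ → φ y = 1)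
    (hφ0 : ∀ y : EuclideanSpace ℝ (Fin 3), ρ₂ ≤ ‖y‖ → φ y = 0)
    (hφ01 : ∀ y, 0 ≤ φ y ∧ φ y ≤ 1) (hCφ : 0 ≤ Cφ) (hdφ : ∀ y, ‖fderiv ℝ φ y‖ ≤ Cφ) (hB : 0 ≤ B)
    (hmP : 0 ≤ mP)
    (hbd : ∀ t ∈ Ioo s₁ 0, ∀ y ∈ {y : EuclideanSpace ℝ (Fin 3) | ρ₁ ≤ ‖y‖ ∧ ‖y‖ ≤ ρ₂},
      ‖V t y‖ ≤ B ∧ ‖(Δ (V t)) y‖ ≤ B ∧ ‖(Δ (fun y => φ y • V t y)) y‖ ≤ B ∧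
        ‖fderiv ℝ (Δ (fun y => φ y • V t y)) y‖ ≤ B)
    (hC : 0 ≤ C) (hrate : ∀ t ∈ Ioo s₁ 0, ∀ y ∈ tsupport φ, ‖V t y‖ ≤ C / Real.sqrt (-t))
    {c : ℝ} (hc : 0 < c) (hfloor : ∀ t ∈ Ioo s₁ 0, c * Real.sqrt (-t) ≤ ∫ y, ‖φ y • V t y‖ ^ 2)
    (hext : Tendsto (fun s => ∫ y, ‖φ y • V s y‖ ^ 2) (𝓝[<] 0) (𝓝 0)) :
    2 ≤ C ^ 2 := by
  have hφc : HasCompactSupport φ := hasCompactSupport_of_cutoff hφ0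
  have hvol : 0 ≤ (volume {y : EuclideanSpace ℝ (Fin 3) | ρ₁ ≤ ‖y‖ ∧ ‖y‖ ≤ ρ₂}).toReal :=
    ENNReal.toReal_nonneg
  have hEpos : ∀ t ∈ Ioo s₁ 0, 0 < ∫ y, ‖φ y • V t y‖ ^ 2 := fun t ht =>
    lt_of_lt_of_le (mul_pos hc (Real.sqrt_pos.2 (by linarith [ht.2]))) (hfloor t ht)
  refine two_le_rateSq_of_identities
    (E := fun s => ∫ y, ‖φ y • V s y‖ ^ 2)
    (D := fun s => ∫ y, frobeniusNormSq (fderiv ℝ (fun y => φ y • V s y) y))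
    (Q₀ := fun s => ∫ y, ‖(Δ (fun y => φ y • V s y)) y‖ ^ 2)
    (S₁ := fun s => (∫ y, frobeniusNormSq (fderiv ℝ (fun y => φ y • V s y) y)) +
      ∫ y, ⟪φ y • V s y, φ y • deriv (fun r => V r y) s⟫)
    (X := fun s => ∫ y, ⟪(Δ (fun y => φ y • V s y)) y +
        ((∫ y, frobeniusNormSq (fderiv ℝ (fun y => φ y • V s y) y)) / ∫ y, ‖φ y • V s y‖ ^ 2) •
          (φ y • V s y), convect (V s) (fun y => φ y • V s y) y⟫)
    (S₂ := fun s => (∫ y, ⟪(Δ (fun y => φ y • V s y)) y, φ y • deriv (fun r => V r y) s⟫) -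
      (∫ y, ‖(Δ (fun y => φ y • V s y)) y‖ ^ 2) +
      ∫ y, ⟪(Δ (fun y => φ y • V s y)) y +
        ((∫ y, frobeniusNormSq (fderiv ℝ (fun y => φ y • V s y) y)) / ∫ y, ‖φ y • V s y‖ ^ 2) •
          (φ y • V s y), convect (V s) (fun y => φ y • V s y) y⟫)
    (β := fun s => C / Real.sqrt (-s))
    (m₁ := (2 * B ^ 2 + Cφ * B ^ 3) *
        (volume {y : EuclideanSpace ℝ (Fin 3) | ρ₁ ≤ ‖y‖ ∧ ‖y‖ ≤ ρ₂}).toReal + 2 * Cφ * B * mP)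
    (m₂ := (2 * B ^ 2 + Cφ * B ^ 3) *
        (volume {y : EuclideanSpace ℝ (Fin 3) | ρ₁ ≤ ‖y‖ ∧ ‖y‖ ≤ ρ₂}).toReal + (3 + Cφ) * B * mP)
    hs₁ hc (by positivity) (by positivity) hfloor ?_ ?_ ?_ ?_ ?_ ?_ ?_ ?_ hext
  · intro s _
    exact integral_nonneg fun y => frobeniusNormSq_nonneg _
  · intro s hs
    exact sq_integral_frobeniusNormSq_le (hφ.smul (hV.contDiff_slice hs)) hφc.smul_right
  · intro s hs
    exact hasDerivAt_cutoffEnergy_shell hV hφ hφc hs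
  · intro s hs
    exact hasDerivAt_cutoffEnstrophy_shell hV hφ hφc hs _ _
  · intro s hs
    exact abs_energySource_le hs hV (hdiv s hs) (hwin s hs) hφ hφ1 hφ0 hφ01 hCφ hdφ hB
      fun y hy => ⟨(hbd s hs y hy).1, (hbd s hs y hy).2.1, (hbd s hs y hy).2.2.1⟩
  · intro s hs
    exact abs_enstrophySource_le hs hV (hdiv s hs) (hwin s hs) hφ hφ1 hφ0 hφ01 hCφ hdφ hB (hbd s hs) _
  · intro s hs
    refine ⟨div_nonneg hC (Real.sqrt_nonneg _), le_of_eq ?_⟩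
    rw [div_pow, Real.sq_sqrt (by linarith [hs.2])]
  · intro s hs
    exact abs_drift_le hs hV hφ hφc hC (hrate s hs) (hEpos s hs)

end Summit.NavierStokesRegularity.NavierStokesRegularity.Theorems.TypeITraceScarL3

end
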